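/-
Copyright (c) 2026. All rights reserved.
Released under Apache 2.0 license as described in the file LICENSE.
Authors: abc-iut cell, cone prover seat abc-iut-w6-d064 (wave W6, block C; abc-iut-L3-lead ruling α48 (2)
«T54·hR-inst»).
-/
import Literature.AnabelianGeometry.SemiGraphs.ArithChartActionAmple
import Literature.AnabelianGeometry.SemiGraphs.ArithTemperedGroupOfOuterAction
import HarnessLib

/-!
# [SemiAnbd] Rmk 5.3.1, first sentence, AT THE OUTER MODEL `π₁^temp(𝒢) ⋊^out Π_A` — the Thm 5.4 (ii)
# capstone binder `hR`, closed by composition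

Mochizuki, *Semi-graphs of anabelioids*, Publ. RIMS **42** (2006), §5: Rmk 5.3.1 p. 65 ("all verticial and
edge-like subgroups of `Π^temp_𝔊` are compact and arithmetically ample"), Prop 5.2 (iv) p. 64 (the exact
sequence `1 → Π^temp_𝔾 → Π^temp_𝔊 → Π_A → 1`), Thm 5.4 (ii) p. 66. [cite: MochizukiSemiAnbd2006, Rmk 5.3.1 p.65]

PROOF-ONLY file (abc-iut cell, seat abc-iut-w6-d064; L3 sub-DAG `plan/L3/SUBDAG-SemiAnbd-Thm54.md`, producer
row T54-B, sub-piece «T54·hR-inst» of abc-iut-L3-lead ruling α48 (2); no definition, no named fact).  The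
capstone binder

  `hR : VerticialEdgeLikeCompactAmpleStatement (decompositionDataOfChart Rc (toOuterSemidirectProduct ρ))
          (outerSemidirectProductSnd ρ)`

of abc-iut-w4-d029's `arithMaximalCompactStatementII_outerAction_piPresentation` (Thm 5.4 (ii) at the
genuine arithmetic tempered group of the chart) is CLOSED BY COMPOSITION of landed theorems:
abc-iut-w4-d029's T54-1 `ArithChartAction.verticialEdgeLikeCompactAmple` (p415435) at the package
`arithChartAction_outerAction` of abc-iut-w4-d082 (Def 5.1 (i) on the chart for `ι := toOuterSemidirectProduct ρ`,
`aug := outerSemidirectProductSnd ρ`, actions read off `baseAct : Π_A → Aut 𝔾`), with the two exactness inputs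
`aug ∘ ι = 1` and `aug` surjective DISCHARGED unconditionally (`outerSemidirectProductSnd_toOuterSemidirectProduct`,
`outerSemidirectProductSnd_surjective` — no slimness needed for these two), leaving as HONEST BINDERS exactly:
Def 5.1 (i)'s data on the base (`hV`, `hE`, `hopen` — Prop 3.6 (iv) at `ρ_𝔾(a)` and (c)), the PAIR-LEVEL branch
conjugation `hconjPair` (= abc-iut-w4-d082's `hBR`-shaped input), and the compactness of the representatives
`hVc`/`hBc` (abc-iut-w4-d040's `hVc_hBc_of_cosetTowerC`, p428611 lineage, supplies the pair BY NAME at the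
coset-tower package).

* `verticialEdgeLikeCompactAmple_outerAction` — the binder `hR`, by composition;
* `verticialEdgeLikeCompactAmple_outerAction_of_pair` — the same taking `hVc ∧ hBc` as ONE conjunction (the
  literal output shape of `hVc_hBc_of_cosetTowerC`).

Nothing here takes a side on [IUTchIII] Cor. 3.12; typed ≠ proved for the binders.
-/

namespace Literature.AnabelianGeometry.SemiGraphs

namespace ProfiniteSemiGraph

open Literature.AnabelianGeometry.EtaleTheta CategoryTheory Topology

universe u w

variable {𝒢 : ProfiniteSemiGraph.{u}} (c : TemperedPiChart 𝒢)
  {PA : Type w} [Group PA] [TopologicalSpace PA] [IsTopologicalGroup PA]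
  (ρ : PA →* TopOut c.G) (baseAct : PA →* Aut 𝒢.graph)
  [TopologicalSpace (outerSemidirectProduct ρ)] [IsTopologicalGroup (outerSemidirectProduct ρ)]

/-- **[SemiAnbd] Rmk 5.3.1 (first sentence) at `Π^temp_𝔊 := π₁^temp(𝒢) ⋊^out Π_A` — the Thm 5.4 (ii)
capstone binder `hR`, CLOSED BY COMPOSITION**: for a graph of anabelioids `𝒢` (`hG`: every branch abuts),
chart representatives `Rc`, an outer action `ρ : Π_A → Out π₁^temp(𝒢)` with base action `baseAct`, GIVEN
Def 5.1 (i)'s data (`hV`, `hE`, `hopen`), the pair-level branch conjugation `hconjPair` and the compactness of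
the verticial / branch representatives (`hVc`, `hBc`), every verticial or edge-like subgroup of the PRODUCED
decomposition data `decompositionDataOfChart Rc ι` is compact and arithmetically ample.  (T54-1
`ArithChartAction.verticialEdgeLikeCompactAmple` ∘ `arithChartAction_outerAction`; `aug ∘ ι = 1` and
`aug` onto are `outerSemidirectProductSnd_toOuterSemidirectProduct` / `outerSemidirectProductSnd_surjective`.)
[cite: MochizukiSemiAnbd2006, Rmk 5.3.1 p.65] -/
theorem verticialEdgeLikeCompactAmple_outerAction (Rc : ChartRepresentatives c) (hG : 𝒢.graph.IsGraph)
    (hV : ∀ (a : PA) (v : 𝒢.graph.Vertex) (H : Subgroup c.G), H ∈ verticialSubgroups c v →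
      ∃ φ : contMulAut c.G, TopOut.mk c.G φ = ρ a ∧
        H.map (φ : MulAut c.G).toMonoidHom ∈ verticialSubgroups c ((baseAct a).hom.vertexMap v))
    (hE : ∀ (a : PA) (e : 𝒢.graph.Edge) (K : Subgroup c.G), K ∈ edgeLikeSubgroups c e →
      ∃ φ : contMulAut c.G, TopOut.mk c.G φ = ρ a ∧
        K.map (φ : MulAut c.G).toMonoidHom ∈ edgeLikeSubgroups c ((baseAct a).hom.edgeMap e))
    (hopen : ∃ U : Subgroup PA, IsOpen (U : Set PA) ∧ ∀ a ∈ U,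
      (∀ v, (baseAct a).hom.vertexMap v = v) ∧ (∀ e, (baseAct a).hom.edgeMap e = e) ∧
        ∀ b, (baseAct a).hom.branchMap b = b)
    (hconjPair : ∀ (b : 𝒢.graph.Branch) (v : 𝒢.graph.Vertex), 𝒢.graph.abuts b = some v →
      ∃ U : Subgroup PA, IsOpen (U : Set PA) ∧ ∀ a ∈ U, ∃ g : outerSemidirectProduct ρ,
        outerSemidirectProductSnd ρ g = a ∧ ∃ h : c.G,
          conjSubgroup g ((Rc.Hv v).map (toOuterSemidirectProduct ρ)) =
              conjSubgroup (toOuterSemidirectProduct ρ h) ((Rc.Hv v).map (toOuterSemidirectProduct ρ)) ∧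
            conjSubgroup g ((Rc.Hb b).map (toOuterSemidirectProduct ρ)) =
              conjSubgroup (toOuterSemidirectProduct ρ h) ((Rc.Hb b).map (toOuterSemidirectProduct ρ)))
    (hVc : ∀ v, IsCompact (arithVertGp Rc (toOuterSemidirectProduct ρ) v : Set (outerSemidirectProduct ρ)))
    (hBc : ∀ b, IsCompact (arithBrGp Rc (toOuterSemidirectProduct ρ) b : Set (outerSemidirectProduct ρ))) :
    VerticialEdgeLikeCompactAmpleStatement (decompositionDataOfChart Rc (toOuterSemidirectProduct ρ))
      (outerSemidirectProductSnd ρ) :=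
  (arithChartAction_outerAction c ρ baseAct hV hE hopen).verticialEdgeLikeCompactAmple Rc
    (outerSemidirectProductSnd_toOuterSemidirectProduct ρ) (outerSemidirectProductSnd_surjective ρ) hG
    hconjPair hVc hBc

/-- The same with the compactness of the representatives as ONE conjunction `hVBc` — the literal output
shape of abc-iut-w4-d040's `hVc_hBc_of_cosetTowerC` at abc-iut-w4-d029's package
`ArithLevelDataCpt.ofCosetTowerC` (so the capstone's `hR` is `verticialEdgeLikeCompactAmple_outerAction_of_pair
… (hVc_hBc_of_cosetTowerC …)`). [cite: MochizukiSemiAnbd2006, Rmk 5.3.1 p.65] -/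
theorem verticialEdgeLikeCompactAmple_outerAction_of_pair (Rc : ChartRepresentatives c)
    (hG : 𝒢.graph.IsGraph)
    (hV : ∀ (a : PA) (v : 𝒢.graph.Vertex) (H : Subgroup c.G), H ∈ verticialSubgroups c v →
      ∃ φ : contMulAut c.G, TopOut.mk c.G φ = ρ a ∧
        H.map (φ : MulAut c.G).toMonoidHom ∈ verticialSubgroups c ((baseAct a).hom.vertexMap v))
    (hE : ∀ (a : PA) (e : 𝒢.graph.Edge) (K : Subgroup c.G), K ∈ edgeLikeSubgroups c e →
      ∃ φ : contMulAut c.G, TopOut.mk c.G φ = ρ a ∧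
        K.map (φ : MulAut c.G).toMonoidHom ∈ edgeLikeSubgroups c ((baseAct a).hom.edgeMap e))
    (hopen : ∃ U : Subgroup PA, IsOpen (U : Set PA) ∧ ∀ a ∈ U,
      (∀ v, (baseAct a).hom.vertexMap v = v) ∧ (∀ e, (baseAct a).hom.edgeMap e = e) ∧
        ∀ b, (baseAct a).hom.branchMap b = b)
    (hconjPair : ∀ (b : 𝒢.graph.Branch) (v : 𝒢.graph.Vertex), 𝒢.graph.abuts b = some v →
      ∃ U : Subgroup PA, IsOpen (U : Set PA) ∧ ∀ a ∈ U, ∃ g : outerSemidirectProduct ρ,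
        outerSemidirectProductSnd ρ g = a ∧ ∃ h : c.G,
          conjSubgroup g ((Rc.Hv v).map (toOuterSemidirectProduct ρ)) =
              conjSubgroup (toOuterSemidirectProduct ρ h) ((Rc.Hv v).map (toOuterSemidirectProduct ρ)) ∧
            conjSubgroup g ((Rc.Hb b).map (toOuterSemidirectProduct ρ)) =
              conjSubgroup (toOuterSemidirectProduct ρ h) ((Rc.Hb b).map (toOuterSemidirectProduct ρ)))
    (hVBc : (∀ v, IsCompact (arithVertGp Rc (toOuterSemidirectProduct ρ) v : Set (outerSemidirectProduct ρ))) ∧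
      ∀ b, IsCompact (arithBrGp Rc (toOuterSemidirectProduct ρ) b : Set (outerSemidirectProduct ρ))) :
    VerticialEdgeLikeCompactAmpleStatement (decompositionDataOfChart Rc (toOuterSemidirectProduct ρ))
      (outerSemidirectProductSnd ρ) :=
  verticialEdgeLikeCompactAmple_outerAction c ρ baseAct Rc hG hV hE hopen hconjPair hVBc.1 hVBc.2

end ProfiniteSemiGraph

end Literature.AnabelianGeometry.SemiGraphs
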